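import Literature.NumberTheory.LFunctions.Zhang2022.SkeletonPartTwo
import Literature.NumberTheory.LFunctions.CharacterHarmonicTails
import Literature.NumberTheory.LFunctions.DirichletLOneTail
import HarnessLib

/-!
# Zhang (2022), Lemma 10.1, part 2/5: elementary estimates for the twisted weights `χ(m)m^{−1−δ}`

Topic `Literature/NumberTheory/LFunctions/Zhang2022` (Landau–Siegel audit tree; verdict-neutral).
Y. Zhang, *Discrete mean estimates and the Landau–Siegel zero*, arXiv:2211.02515v1 (2022)
[Zhang2022LandauSiegel] — **an unrefereed manuscript under adjudication**; this file proves one of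
its lemmas from the manuscript's own definitions and asserts nothing about its Theorems 1–2.
Cell siegel-zhang (D-0069 width campaign), discharge of DAG node `Z22:Lem10.1` / proof node
`Z22:Lem10.1.pf` [Z22 pp. 53–54, (10.2)–(10.7), tex L2723–2788], skeleton node
`Skeleton.Lemma101 c′` (`SkeletonPartTwo`), cone C24 of `theorem1_of_leaves`.

Content (the "partial summation" of the printed proof, elementary half): `‖eᵃ − eᵇ‖`, consecutive
differences `‖n^s − (n+1)^s‖ ≤ 4/(n(n+1))` (`Re s = −1`), `‖m^{−1−δ} − m⁻¹‖ ≤ 2‖δ‖log m/m`,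
`Σ_{m≤N}1/m ≤ 1 + log N`, telescoping `Σ 1/(n(n+1))`, `2L ≤ L^{1.1}` (`L ≥ 1024`), and the two
inputs of the short-sum bound: `‖Σ_{m≤D} χ(m)m^{−1−δ}‖ ≤ ‖L(1,χ)‖ + 2√D(1+log D)/(D+1)
+ 2‖δ‖log D(1+log D)` (Pólya–Vinogradov tail of `Σχ(m)/m`, tree
`DirichletAbel.norm_sum_div_sub_LFunction_one_le_polyaVinogradov`) and the consecutive
differences of `n ↦ n^{−1−δ}log(X/n)`.

## References
* Y. Zhang, arXiv:2211.02515v1 (2022), §10, proof of Lemma 10.1 ("Polya-Vinogradov inequality and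
  partial summation"). [cite: Zhang2022LandauSiegel, §10 Lemma 10.1]
* H. L. Montgomery, R. C. Vaughan, *Multiplicative Number Theory I*, CUP 2007, §9.4 Thm. 9.18,
  §11.2.1 Ex. 3(a). [cite: MontgomeryVaughan2007, §9.4 and §11.2.1]
-/

noncomputable section

open Complex Real

namespace Literature.NumberTheory.LFunctions.Zhang2022.Lemma101

open Literature.NumberTheory.LFunctions.Zhang2022.Skeleton
open Literature.NumberTheory.LFunctions.Zhang2022.Lemma82 (twist C82)

variable {D : ℕ} (χ : DirichletCharacter ℂ D)

/-! ### §3. Elementary estimates -/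

omit χ in
/-- `‖eᵃ − eᵇ‖ ≤ 2‖a − b‖e^{Re b}` for `‖a − b‖ ≤ 1`. [folklore] -/
private theorem norm_exp_sub_exp_le {a b : ℂ} (h : ‖a - b‖ ≤ 1) :
    ‖Complex.exp a - Complex.exp b‖ ≤ 2 * ‖a - b‖ * Real.exp b.re := by
  have e : Complex.exp a - Complex.exp b = Complex.exp b * (Complex.exp (a - b) - 1) := by
    rw [mul_sub, mul_one, ← Complex.exp_add, add_sub_cancel]
  rw [e, norm_mul, Complex.norm_exp]
  have h2 := Complex.norm_exp_sub_one_le h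
  have h3 := Real.exp_pos b.re
  nlinarith [norm_nonneg (a - b)]

omit χ in
/-- `n^s = exp(s log n)` for `n ≥ 1`. [folklore] -/
private theorem natCast_cpow_eq_exp {n : ℕ} (hn : n ≠ 0) (s : ℂ) :
    (n : ℂ) ^ s = Complex.exp ((Real.log n : ℂ) * s) := by
  rw [Complex.cpow_def_of_ne_zero (Nat.cast_ne_zero.mpr hn), Complex.natCast_log]

omit χ in
/-- `‖n^s − (n+1)^s‖ ≤ 4/(n(n+1))` for `Re s = −1`, `‖s‖ ≤ 2`, `n ≥ 2` (an explicit constant for the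
printed "partial summation"). [cite: Zhang2022LandauSiegel, §10 Lemma 10.1 (proof, partial summation)] -/
theorem norm_cpow_sub_cpow_succ_le {n : ℕ} (hn : 2 ≤ n) {s : ℂ} (hs : s.re = -1)
    (hs2 : ‖s‖ ≤ 2) :
    ‖(n : ℂ) ^ s - ((n + 1 : ℕ) : ℂ) ^ s‖ ≤ 4 / ((n : ℝ) * (n + 1)) := by
  have hn0 : (0 : ℝ) < n := by exact_mod_cast (by omega : 0 < n)
  have hn1 : (0 : ℝ) < ((n + 1 : ℕ) : ℝ) := by positivity
  rw [natCast_cpow_eq_exp (by omega) s, natCast_cpow_eq_exp (by omega) s]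
  set a : ℂ := (Real.log n : ℂ) * s with ha
  set b : ℂ := (Real.log ((n + 1 : ℕ) : ℝ) : ℂ) * s with hb
  have hlog0 : 0 ≤ Real.log ((n + 1 : ℕ) : ℝ) - Real.log n := by
    rw [sub_nonneg]
    exact Real.log_le_log hn0 (by push_cast; linarith)
  have hlog : Real.log ((n + 1 : ℕ) : ℝ) - Real.log n ≤ 1 / n := by
    rw [← Real.log_div hn1.ne' hn0.ne']
    calc Real.log (((n + 1 : ℕ) : ℝ) / n) ≤ ((n + 1 : ℕ) : ℝ) / n - 1 :=
          Real.log_le_sub_one_of_pos (by positivity)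
      _ = 1 / n := by push_cast; field_simp; ring
  have hab : a - b = ((Real.log n - Real.log ((n + 1 : ℕ) : ℝ) : ℝ) : ℂ) * s := by
    rw [ha, hb]; push_cast; ring
  have hnab : ‖a - b‖ ≤ 2 / n := by
    rw [hab, norm_mul, Complex.norm_real, Real.norm_eq_abs, abs_sub_comm, abs_of_nonneg hlog0]
    calc (Real.log ((n + 1 : ℕ) : ℝ) - Real.log n) * ‖s‖ ≤ 1 / n * 2 := by gcongr
      _ = 2 / n := by ring
  have hab1 : ‖a - b‖ ≤ 1 := by
    refine hnab.trans ?_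
    rw [div_le_one hn0]
    exact_mod_cast hn
  have hbre : b.re = -Real.log ((n + 1 : ℕ) : ℝ) := by
    rw [hb, Complex.re_ofReal_mul, hs]; ring
  calc ‖Complex.exp a - Complex.exp b‖ ≤ 2 * ‖a - b‖ * Real.exp b.re := norm_exp_sub_exp_le hab1
    _ ≤ 2 * (2 / n) * Real.exp b.re := by gcongr
    _ = 4 / ((n : ℝ) * (n + 1)) := by
        rw [hbre, Real.exp_neg, Real.exp_log hn1]
        push_cast
        field_simp
        norm_num

omit χ in
/-- `‖m^{−1−δ} − m⁻¹‖ ≤ 2‖δ‖log m/m` when `‖δ‖log m ≤ 1`, `m ≥ 1`. [folklore] -/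
private theorem norm_cpow_sub_inv_le {m : ℕ} (hm : 0 < m) {δ : ℂ} (h : ‖δ‖ * Real.log m ≤ 1) :
    ‖(m : ℂ) ^ (-1 - δ) - (m : ℂ)⁻¹‖ ≤ 2 * ‖δ‖ * Real.log m / m := by
  have hm0 : (0 : ℝ) < m := by exact_mod_cast hm
  have hlog0 : 0 ≤ Real.log m := Real.log_nonneg (by exact_mod_cast hm)
  rw [← Complex.cpow_neg_one, natCast_cpow_eq_exp hm.ne', natCast_cpow_eq_exp hm.ne']
  set a : ℂ := (Real.log m : ℂ) * (-1 - δ) with ha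
  set b : ℂ := (Real.log m : ℂ) * (-1) with hb
  have hab : a - b = -((Real.log m : ℂ) * δ) := by rw [ha, hb]; ring
  have hnab : ‖a - b‖ = ‖δ‖ * Real.log m := by
    rw [hab, norm_neg, norm_mul, Complex.norm_real, Real.norm_eq_abs, abs_of_nonneg hlog0, mul_comm]
  have hbre : b.re = -Real.log m := by
    rw [hb, Complex.re_ofReal_mul]; simp
  calc ‖Complex.exp a - Complex.exp b‖ ≤ 2 * ‖a - b‖ * Real.exp b.re :=
        norm_exp_sub_exp_le (by rw [hnab]; exact h)
    _ = 2 * ‖δ‖ * Real.log m / m := by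
        rw [hnab, hbre, Real.exp_neg, Real.exp_log hm0]
        field_simp

/-- `‖χ(m)m^{−1−δ}‖ ≤ 1/m` for `δ` purely imaginary. [cite: Zhang2022LandauSiegel, §10 Lemma 10.1 (proof, partial summation)] -/
theorem norm_twist_le {δ : ℂ} (hδ : δ.re = 0) {m : ℕ} (hm : 0 < m) :
    ‖twist χ δ m‖ ≤ (m : ℝ)⁻¹ := by
  rw [twist, norm_mul, Complex.norm_natCast_cpow_of_pos hm]
  have hre : (-1 - δ).re = -1 := by simp [hδ]
  rw [hre, Real.rpow_neg_one]
  have := DirichletCharacter.norm_le_one χ (m : ZMod D)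
  calc ‖χ (m : ZMod D)‖ * (m : ℝ)⁻¹ ≤ 1 * (m : ℝ)⁻¹ := by gcongr
    _ = (m : ℝ)⁻¹ := one_mul _

omit χ in
/-- `Σ_{m≤N} 1/m ≤ 1 + log N` (Mathlib's `harmonic_le_one_add_log`, reindexed). [cite: Zhang2022LandauSiegel, §10 Lemma 10.1 (proof, partial summation)] -/
theorem sum_Ioc_inv_le (N : ℕ) : ∑ m ∈ Finset.Ioc 0 N, (m : ℝ)⁻¹ ≤ 1 + Real.log N := by
  have h := harmonic_le_one_add_log N
  rw [harmonic_eq_sum_Icc, Rat.cast_sum] at h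
  simp only [Rat.cast_inv, Rat.cast_natCast] at h
  have hI : Finset.Ioc 0 N = Finset.Icc 1 N := by
    ext m; simp only [Finset.mem_Ioc, Finset.mem_Icc]; omega
  rwa [hI]

omit χ in
/-- `Σ_{a<n≤b} 1/(n(n+1)) = 1/(a+1) − 1/(b+1)` (telescoping). [cite: Zhang2022LandauSiegel, §10 Lemma 10.1 (proof, partial summation)] -/
theorem sum_Ioc_inv_mul_succ (a b : ℕ) (hab : a ≤ b) :
    ∑ n ∈ Finset.Ioc a b, (1 / ((n : ℝ) * (n + 1))) = 1 / ((a : ℝ) + 1) - 1 / ((b : ℝ) + 1) := by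
  induction b, hab using Nat.le_induction with
  | base => simp
  | succ b hb ih =>
    rw [Finset.sum_Ioc_succ_top hb, ih]
    have h1 : ((b : ℝ) + 1) ≠ 0 := by positivity
    have h2 : ((b + 1 : ℕ) : ℝ) + 1 ≠ 0 := by positivity
    have h3 : ((b + 1 : ℕ) : ℝ) ≠ 0 := by positivity
    push_cast at h2 h3 ⊢
    field_simp
    ring

omit χ in
/-- `6L²(1 + L) ≤ e^{L/2}` for `L ≥ 200` (`√D` beats the powers of `𝓛` in the Pólya–Vinogradov
terms). [cite: Zhang2022LandauSiegel, §10 Lemma 10.1 (proof, partial summation)] -/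
theorem six_mul_sq_mul_le_exp_half {L : ℝ} (hL : 200 ≤ L) :
    6 * L ^ 2 * (1 + L) ≤ Real.exp (L / 2) := by
  have hL0 : 0 ≤ L := by linarith
  have h := Real.pow_div_factorial_le_exp (L / 2) (by linarith) 5
  have h5 : (Nat.factorial 5 : ℝ) = 120 := by norm_num [Nat.factorial]
  rw [h5] at h
  have h3 : 200 * 200 * L ≤ L * L * L := by gcongr
  nlinarith

/-! ### §4. The short Riesz logarithmic means: `‖A(X)‖ ≪ 𝓛²` for `X ≤ T` -/

omit χ in
/-- Reindexing `Σ_{n<M} f(n+1) = Σ_{0<m≤M} f(m)`. [folklore] -/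
private theorem sum_range_succ_eq_sum_Ioc (f : ℕ → ℂ) (M : ℕ) :
    ∑ n ∈ Finset.range M, f (n + 1) = ∑ m ∈ Finset.Ioc 0 M, f m := by
  induction M with
  | zero => simp
  | succ M ih => rw [Finset.sum_range_succ, Finset.sum_Ioc_succ_top (Nat.zero_le _), ih]

/-- Standing numerics from `200 + Kπ ≤ 𝓛` ("`D` large"): `D ≥ 2`, `D = e^𝓛`, `√D = e^{𝓛/2}`,
`Kπ ≤ 𝓛`. [cite: Zhang2022LandauSiegel, §2 p. 4 and §10 Lemma 10.1] -/
theorem basics_of_large [NeZero D] {K : ℝ} (hK0 : 0 ≤ K) (hL : 200 + K * π ≤ Real.log D) :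
    2 ≤ D ∧ 200 ≤ Real.log D ∧ (D : ℝ) = Real.exp (Real.log D) ∧
      Real.sqrt D = Real.exp (Real.log D / 2) ∧ K * π ≤ Real.log D := by
  have hπ := Real.pi_pos
  have hKπ : 0 ≤ K * π := by positivity
  have hL200 : 200 ≤ Real.log D := by linarith
  have hD2 : 2 ≤ D := by
    rcases Nat.lt_or_ge D 2 with h | h
    · interval_cases D <;> norm_num at hL200
    · exact h
  have hD0 : (0 : ℝ) < D := by exact_mod_cast (by omega : 0 < D)
  have hDexp : (D : ℝ) = Real.exp (Real.log D) := (Real.exp_log hD0).symm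
  refine ⟨hD2, hL200, hDexp, ?_, by linarith⟩
  have h2 : Real.exp (Real.log D / 2) ^ 2 = D := by
    rw [sq, ← Real.exp_add, add_halves, ← hDexp]
  rw [show Real.sqrt (D : ℝ) = Real.sqrt (Real.exp (Real.log D / 2) ^ 2) by rw [h2],
    Real.sqrt_sq (Real.exp_pos _).le]

/-- **`B = Σ_{m≤D} χ(m)m^{−1−δ}` is small**: `‖B‖ ≤ ‖L(1,χ)‖ + 2√D(1+log D)/(D+1)
+ 2‖δ‖log D(1 + log D)` (Pólya–Vinogradov tail of `Σχ(m)/m` and `m^{−δ} = 1 + O(‖δ‖log m)`).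
[cite: MontgomeryVaughan2007, §11.2.1 Exercise 3(a)] -/
theorem norm_twist_partial_sum_le [NeZero D] (hprim : χ.IsPrimitive) (hD2 : 2 ≤ D) {δ : ℂ}
    (hδL : ‖δ‖ * Real.log D ≤ 1) :
    ‖∑ m ∈ Finset.Ioc 0 D, twist χ δ m‖ ≤ ‖χ.LFunction 1‖ +
      2 * (Real.sqrt D * (1 + Real.log D)) / ((D : ℝ) + 1) +
        2 * ‖δ‖ * Real.log D * (1 + Real.log D) := by
  set L : ℝ := Real.log D with hLdef
  have hD0 : (0 : ℝ) < D := by exact_mod_cast (by omega : 0 < D)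
  have hdec : ∑ m ∈ Finset.Ioc 0 D, twist χ δ m =
      (∑ m ∈ Finset.Ioc 0 D, χ (m : ZMod D) * (m : ℂ)⁻¹) +
        ∑ m ∈ Finset.Ioc 0 D, χ (m : ZMod D) * ((m : ℂ) ^ (-1 - δ) - (m : ℂ)⁻¹) := by
    rw [← Finset.sum_add_distrib]
    refine Finset.sum_congr rfl fun m _ => ?_
    rw [twist]; ring
  -- the harmonic character sum vs `L(1,χ)`
  have hharm : ‖(∑ m ∈ Finset.Ioc 0 D, χ (m : ZMod D) * (m : ℂ)⁻¹) - χ.LFunction 1‖ ≤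
      2 * (Real.sqrt D * (1 + L)) / ((D : ℝ) + 1) := by
    have h := DirichletAbel.norm_sum_div_sub_LFunction_one_le_polyaVinogradov χ hD2 hprim D
    have hre : ∑ n ∈ Finset.range D, χ ((n + 1 : ℕ) : ZMod D) / ((n : ℂ) + 1) =
        ∑ m ∈ Finset.Ioc 0 D, χ (m : ZMod D) * (m : ℂ)⁻¹ := by
      rw [← sum_range_succ_eq_sum_Ioc]
      refine Finset.sum_congr rfl fun n _ => ?_
      push_cast
      rw [div_eq_mul_inv]
    rw [hre] at h
    exact h
  -- the perturbation `m^{-δ} − 1`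
  have hpert : ‖∑ m ∈ Finset.Ioc 0 D, χ (m : ZMod D) * ((m : ℂ) ^ (-1 - δ) - (m : ℂ)⁻¹)‖ ≤
      2 * ‖δ‖ * L * (1 + L) := by
    calc ‖∑ m ∈ Finset.Ioc 0 D, χ (m : ZMod D) * ((m : ℂ) ^ (-1 - δ) - (m : ℂ)⁻¹)‖
        ≤ ∑ m ∈ Finset.Ioc 0 D, ‖χ (m : ZMod D) * ((m : ℂ) ^ (-1 - δ) - (m : ℂ)⁻¹)‖ :=
          norm_sum_le _ _
      _ ≤ ∑ m ∈ Finset.Ioc 0 D, (m : ℝ)⁻¹ * (2 * ‖δ‖ * L) := by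
          refine Finset.sum_le_sum fun m hm => ?_
          rw [Finset.mem_Ioc] at hm
          have hm0 : (0 : ℝ) < m := by exact_mod_cast hm.1
          have hlm0 : 0 ≤ Real.log m := Real.log_nonneg (by exact_mod_cast hm.1)
          have hlmL : Real.log m ≤ L := Real.log_le_log hm0 (by exact_mod_cast hm.2)
          have hsmall : ‖δ‖ * Real.log m ≤ 1 :=
            (mul_le_mul_of_nonneg_left hlmL (norm_nonneg _)).trans hδL
          rw [norm_mul]
          calc ‖χ (m : ZMod D)‖ * ‖(m : ℂ) ^ (-1 - δ) - (m : ℂ)⁻¹‖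
              ≤ 1 * (2 * ‖δ‖ * Real.log m / m) :=
                mul_le_mul (DirichletCharacter.norm_le_one χ _) (norm_cpow_sub_inv_le hm.1 hsmall)
                  (norm_nonneg _) zero_le_one
            _ ≤ (m : ℝ)⁻¹ * (2 * ‖δ‖ * L) := by
                rw [one_mul, div_eq_inv_mul]
                gcongr
      _ = (∑ m ∈ Finset.Ioc 0 D, (m : ℝ)⁻¹) * (2 * ‖δ‖ * L) := by rw [Finset.sum_mul]
      _ ≤ (1 + L) * (2 * ‖δ‖ * L) :=
          mul_le_mul_of_nonneg_right (sum_Ioc_inv_le D) (by positivity)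
      _ = 2 * ‖δ‖ * L * (1 + L) := by ring
  rw [hdec]
  calc ‖(∑ m ∈ Finset.Ioc 0 D, χ (m : ZMod D) * (m : ℂ)⁻¹) +
        ∑ m ∈ Finset.Ioc 0 D, χ (m : ZMod D) * ((m : ℂ) ^ (-1 - δ) - (m : ℂ)⁻¹)‖
      ≤ ‖∑ m ∈ Finset.Ioc 0 D, χ (m : ZMod D) * (m : ℂ)⁻¹‖ +
          ‖∑ m ∈ Finset.Ioc 0 D, χ (m : ZMod D) * ((m : ℂ) ^ (-1 - δ) - (m : ℂ)⁻¹)‖ :=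
        norm_add_le _ _
    _ ≤ (‖χ.LFunction 1‖ + 2 * (Real.sqrt D * (1 + L)) / ((D : ℝ) + 1)) +
          2 * ‖δ‖ * L * (1 + L) := by
        refine add_le_add ?_ hpert
        calc ‖∑ m ∈ Finset.Ioc 0 D, χ (m : ZMod D) * (m : ℂ)⁻¹‖
            = ‖χ.LFunction 1 + ((∑ m ∈ Finset.Ioc 0 D, χ (m : ZMod D) * (m : ℂ)⁻¹) -
                χ.LFunction 1)‖ := by rw [add_sub_cancel]
          _ ≤ ‖χ.LFunction 1‖ + ‖(∑ m ∈ Finset.Ioc 0 D, χ (m : ZMod D) * (m : ℂ)⁻¹) -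
                χ.LFunction 1‖ := norm_add_le _ _
          _ ≤ ‖χ.LFunction 1‖ + 2 * (Real.sqrt D * (1 + L)) / ((D : ℝ) + 1) := by
              gcongr
    _ = _ := by ring

omit χ in
/-- The consecutive differences of `n ↦ n^{−1−δ}log(X/n)` for `2 ≤ n ≤ X`, `log X ≤ B`, `1 ≤ B`:
`≤ 5B/(n(n+1))` (the variation bound of the printed partial summation). [cite: Zhang2022LandauSiegel, §10 Lemma 10.1 (proof, partial summation)] -/
theorem norm_weight_sub_succ_le {δ : ℂ} (hδre : δ.re = 0) (hδ1 : ‖δ‖ ≤ 1) {X B : ℝ} (hX0 : 0 < X)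
    (hlogX : Real.log X ≤ B) (hB1 : 1 ≤ B) {n : ℕ} (hn2 : 2 ≤ n) (hnX : (n : ℝ) ≤ X) :
    ‖(n : ℂ) ^ (-1 - δ) * (Real.log (X / n) : ℂ) -
        ((n + 1 : ℕ) : ℂ) ^ (-1 - δ) * (Real.log (X / ((n + 1 : ℕ) : ℝ)) : ℂ)‖ ≤
      5 * B / ((n : ℝ) * (n + 1)) := by
  have hn0 : (0 : ℝ) < n := by exact_mod_cast (by omega : 0 < n)
  have hn1 : (0 : ℝ) < ((n + 1 : ℕ) : ℝ) := by positivity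
  have hsre : (-1 - δ).re = -1 := by simp [hδre]
  have hs2 : ‖(-1 : ℂ) - δ‖ ≤ 2 := by
    calc ‖(-1 : ℂ) - δ‖ ≤ ‖(-1 : ℂ)‖ + ‖δ‖ := norm_sub_le _ _
      _ ≤ 1 + 1 := by rw [norm_neg, norm_one]; exact add_le_add le_rfl hδ1
      _ = 2 := by norm_num
  have hl0 : 0 ≤ Real.log (X / n) := Real.log_nonneg ((one_le_div hn0).mpr hnX)
  have hlX : Real.log (X / n) ≤ B := by
    rw [Real.log_div hX0.ne' hn0.ne']
    linarith [Real.log_nonneg (show (1 : ℝ) ≤ n by exact_mod_cast (by omega : 1 ≤ n))]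
  have hld : Real.log (X / n) - Real.log (X / ((n + 1 : ℕ) : ℝ)) =
      Real.log ((n + 1 : ℕ) : ℝ) - Real.log n := by
    rw [Real.log_div hX0.ne' hn0.ne', Real.log_div hX0.ne' hn1.ne']
    ring
  have hld0 : 0 ≤ Real.log ((n + 1 : ℕ) : ℝ) - Real.log n := by
    rw [sub_nonneg]; exact Real.log_le_log hn0 (by push_cast; linarith)
  have hld1 : Real.log ((n + 1 : ℕ) : ℝ) - Real.log n ≤ 1 / n := by
    rw [← Real.log_div hn1.ne' hn0.ne']
    calc Real.log (((n + 1 : ℕ) : ℝ) / n) ≤ ((n + 1 : ℕ) : ℝ) / n - 1 :=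
          Real.log_le_sub_one_of_pos (by positivity)
      _ = 1 / n := by push_cast; field_simp; ring
  have h1 : ‖(n : ℂ) ^ (-1 - δ) - ((n + 1 : ℕ) : ℂ) ^ (-1 - δ)‖ ≤ 4 / ((n : ℝ) * (n + 1)) :=
    norm_cpow_sub_cpow_succ_le hn2 hsre hs2
  have h2 : ‖((n + 1 : ℕ) : ℂ) ^ (-1 - δ)‖ = 1 / ((n : ℝ) + 1) := by
    rw [Complex.norm_natCast_cpow_of_pos (Nat.succ_pos n), hsre, Real.rpow_neg_one]
    push_cast
    rw [one_div]
  have e : (n : ℂ) ^ (-1 - δ) * (Real.log (X / n) : ℂ) -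
      ((n + 1 : ℕ) : ℂ) ^ (-1 - δ) * (Real.log (X / ((n + 1 : ℕ) : ℝ)) : ℂ) =
      ((n : ℂ) ^ (-1 - δ) - ((n + 1 : ℕ) : ℂ) ^ (-1 - δ)) * (Real.log (X / n) : ℂ) +
        ((n + 1 : ℕ) : ℂ) ^ (-1 - δ) *
          ((Real.log (X / n) - Real.log (X / ((n + 1 : ℕ) : ℝ)) : ℝ) : ℂ) := by
    push_cast; ring
  rw [e]
  have hA : ‖((n : ℂ) ^ (-1 - δ) - ((n + 1 : ℕ) : ℂ) ^ (-1 - δ)) * (Real.log (X / n) : ℂ)‖ ≤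
      4 / ((n : ℝ) * (n + 1)) * B := by
    rw [norm_mul, Complex.norm_real, Real.norm_of_nonneg hl0]
    exact mul_le_mul h1 hlX hl0 (by positivity)
  have hB : ‖((n + 1 : ℕ) : ℂ) ^ (-1 - δ) *
      ((Real.log (X / n) - Real.log (X / ((n + 1 : ℕ) : ℝ)) : ℝ) : ℂ)‖ ≤
      1 / ((n : ℝ) + 1) * (1 / n) := by
    rw [norm_mul, h2, Complex.norm_real, Real.norm_eq_abs, hld, abs_of_nonneg hld0]
    exact mul_le_mul_of_nonneg_left hld1 (by positivity)
  calc _ ≤ 4 / ((n : ℝ) * (n + 1)) * B + 1 / ((n : ℝ) + 1) * (1 / n) :=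
        (norm_add_le _ _).trans (add_le_add hA hB)
    _ = (4 * B + 1) / ((n : ℝ) * (n + 1)) := by
        field_simp
    _ ≤ 5 * B / ((n : ℝ) * (n + 1)) := by
        gcongr
        linarith

omit χ in
/-- `2L ≤ L^{1.1}` for `L ≥ 1024`, i.e. `D² ≤ T` (`T = exp 𝓛^{1.1}`, §6). [cite: Zhang2022LandauSiegel, §6 p. 12 and §10 (10.2)] -/
theorem two_mul_le_rpow {L : ℝ} (hL : 1024 ≤ L) : 2 * L ≤ L ^ (11 / 10 : ℝ) := by
  have hL0 : 0 < L := by linarith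
  have h2 : (2 : ℝ) = (1024 : ℝ) ^ (1 / 10 : ℝ) := by
    rw [show (1024 : ℝ) = 2 ^ (10 : ℕ) by norm_num, show (1 / 10 : ℝ) = ((10 : ℕ) : ℝ)⁻¹ by norm_num,
      Real.pow_rpow_inv_natCast (by norm_num) (by norm_num)]
  have h3 : (1024 : ℝ) ^ (1 / 10 : ℝ) ≤ L ^ (1 / 10 : ℝ) :=
    Real.rpow_le_rpow (by norm_num) hL (by norm_num)
  rw [show (11 / 10 : ℝ) = 1 + 1 / 10 by norm_num, Real.rpow_add hL0, Real.rpow_one]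
  calc 2 * L = L * 2 := mul_comm _ _
    _ ≤ L * L ^ (1 / 10 : ℝ) := mul_le_mul_of_nonneg_left (h2 ▸ h3) hL0.le


end Literature.NumberTheory.LFunctions.Zhang2022.Lemma101
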